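import Summits.CriticalPhenomena.SAWScalingLimit.Theses.SAWLoopLift
import HarnessLib.Audit

/-!
# Line `birth` — registered skeleton (BC3) for the crux `GasRegularity` (stmt-CriticalPhenomena-4848)

Route `SAWLoopLift` of `CriticalPhenomena/SAWScalingLimit`, crux C2 (rank 4): **lattice → continuum for the
critical self-avoiding polygon gas on gate events, GIVEN the conformal-radius law with constant `c`**:
`∀ c > 0, C1(c) → ∀ R, ∃ ν` on the Hausdorff hyperspace `NonemptyCompacts ℂ` (Borel σ-algebra bound
in-statement) with (a) `ν`-a.e. point a simple-loop trace, (b) `ν`-a.e. point inside `B(0,R)`, (c) the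
conformal-radius masses `ν{T ⊆ U, T surrounds z, T ⊄ V} = c·log(|φ_U'(0)|/|φ_V'(0)|)` for Jordan
`V ⊆ U ⊆ B(0,R)`, and (d) for every Dobrushin domain with closure in `B(0,R)`: a gate threshold `ε₀` below
which `0 < ν(G_ε) < ∞`, `ν_δ(G_ε) → ν(G_ε)` and `ν_δ(G_ε ∩ {T ∩ K = ∅}) → ν(G_ε ∩ {T ∩ K = ∅})`
(`K ⊆ Ω` compact regular closed), `ν_δ = Σ_P x_c^{|P|} δ_{trace P}` the polygon gas of `δℤ²`.

## The cut — four inputs of four different natures (5 registered stubs)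

Clauses (a)–(c) say "`ν` is a WERNER WINDOW MEASURE with constant `c`" (`IsWernerWindow ν c R`, the common
hypothesis shape of the route's `WernerDetermination` — PROVED, `Theorems/SAWLoopLiftWernerDetermination.lean` —
and `GateFactorisation`); by determination there is AT MOST ONE such `ν` per `(c, R)`, so the existential of
the crux splits soundly into EXISTENCE of the continuum object and CONVERGENCE of the lattice gas to ANY such
object:

* `stub_localMass` (LATTICE, a-priori; the crux's own first why-might-fail) — uniform local finiteness of the
  macroscopic gas: the `x_c`-mass of polygons of `δℤ²` drawn in `B(0,R)` with diameter `≥ r` is bounded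
  uniformly in `δ ∈ (0, δ₀)`.  Encodes the SAP hyperscaling `2 - α = 2ν` (`p_n μ^{-n} ≍ n^{-5/2}`); open on
  `ℤ²` (even `Σ p_n μ^{-n} < ∞` is not in print, MadrasSlade1993 §3.2).  Numerically testable.
* `stub_thinDecay` (LATTICE, a-priori; the "no macroscopic pinching" input in a form the hyperspace can see) —
  macroscopic polygons in a window that surround NO disc of radius `ρ` ("thin everywhere") have total
  `x_c`-mass `≤ θ` once `ρ` is small, uniformly in `δ ∈ (0, δ₀)`.  Why it is here: Hausdorff convergence of
  TRACES forgets multiplicity (a thin C-shaped double strand converges to a circle ARC-SET, a thin annular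
  double strand to a CIRCLE), so "the limit is carried by simple loops" at trace level does not stop mass
  leaking between the crux's surround/exit/avoid events; every identification of the gas through Werner's
  π-system (loops `⊆ U`, surrounding `z`, `⊄ V`) needs thin polygons to be asymptotically massless.
* `stub_wernerWindowExists` (CONTINUUM, existence; Werner2008SelfAvoidingLoops Thm 1 / Prop. 3, unformalised)
  — for every `c > 0` and window `R` there is a Werner window measure (`c/c₀ ×` Werner's self-avoiding loop
  measure restricted to loops inside `B(0,R)`; construction via Brownian-loop outer boundaries or `SLE_{8/3}`).
* `stub_gatePositive` (CONTINUUM, support & local finiteness) — every Werner window measure gives the gate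
  events `G_ε` of a Dobrushin domain with closure in the window positive finite mass for `ε < ε₁(D, R)`
  (finite: `G_ε` forces `T` to meet both gate balls, so `diam T ≥ |a - b| - 2ε`; positive: full support of
  Werner's measure on loops crossing `∂Ω` exactly inside the two gates).
* `stub_gateConvergence` (LATTICE → CONTINUUM, the heart; hardest) — given local mass bounds, thin decay, the
  conformal-radius law `C1(c)` and ANY Werner window measure `ν` (constant `c`, window `R`): the lattice gate
  masses converge, `gasMass δ (G_ε) → ν(G_ε)` and `gasMass δ (G_ε ∧ avoid K) → ν(G_ε ∧ avoid K)` for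
  `ε < ε₂(D, R)`.  Content: subsequential limits of the windowed macroscopic gas (compact hyperspace of a
  closed disc + local mass ⇒ free), identification of every limit as a Werner window measure (C1 squeezed
  through Jordan pairs, thin decay, Werner determination ⇒ all limits agree ⇒ full `δ → 0⁺` filter), and
  continuity of the gate events for the limit (loops tangent to a fixed circle / touching `∂Ω ∖ gates` or `K`
  without crossing are `ν`-null; crossing `∂Ω` outside the gates is NOT a small perturbation among continua
  through the gates — the frontier must be taken relative to connected compacts, where it is the
  touch-without-crossing set).  TRUE iff the convergence holds for the actual limit: by `WernerDetermination`
  any two Werner window measures with the same `(c, R)` coincide.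

`GasRegularity_of` (kernel-checked, no `sorry` of its own) takes `ν` from `stub_wernerWindowExists`, reads off
(a)–(c), and for each Dobrushin domain combines the thresholds of `stub_gatePositive` and
`stub_gateConvergence` (`ε₀ = min ε₁ ε₂`), the latter fed with `stub_localMass`, `stub_thinDecay` and `C1(c)`.
Its hypotheses are the five stubs under their registered names (`Sig.stub_…`, `rfl`-aliases: the skeleton
audit admits hypotheses by registered stub NAME) and its conclusion is the route decl
`Summit.CriticalPhenomena.SAWScalingLimit.Theses.SAWLoopLift.GasRegularity` BY NAME.

Vocabulary (`trace`, `gasMass`, `CRLaw`, `IsWernerWindow`, `gate`, `LocalMassBound`, `ThinDecay`) is the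
crux's own text cut into named pieces (same `open scoped Classical` elaboration as the route file, so the
pieces are definitionally the crux's `let`-bound `tr`, `M`, `G`); it is meant to land verbatim as
`Theorems/SAWLoopLiftGasRegularityDefs.lean` (sorry-free definitions + the `Sig.stub_*` statements) before the
first stub lands `--supports stmt-CriticalPhenomena-4848` (playbook pattern 2).

Disproof / negatives used: no `Disproof.lean` exists for this crux (no workfiles at registration,
`ledger crux ls stmt-CriticalPhenomena-4848`, 2026-08-17); `ledger negatives --problem CriticalPhenomena`
(11 entries): the only SAW-gas-adjacent one is stmt-0772 (tightness of lattice SAW laws over ALL meshes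
`δ ∈ (0,1]`); every `δ`-quantifier below is `∀ δ ∈ (0, δ₀)` with `δ₀` existential or along `𝓝[>] 0`, so the
far-mesh witness does not apply; no stub quantifies a bound over all meshes.
-/

noncomputable section

open scoped BigOperators Topology Manifold Classical MeasureTheory ProbabilityTheory Matrix InnerProductSpace ComplexConjugate ContinuousMap
open Filter Set Function TopologicalSpace MeasureTheory
open Literature.Probability.RandomPlanarGeometry Literature.Probability.LatticeModels

namespace Summit.CriticalPhenomena.SAWScalingLimit.Cruxes.GasRegularity.Birth

/-! ### 0. The Borel structure of the Hausdorff hyperspace (the crux binds `borel _` in-statement) -/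

/-- Borel σ-algebra of the Hausdorff metric on `NonemptyCompacts ℂ` (same term as the crux's `letI`). -/
instance instMeasurableSpaceNonemptyCompacts : MeasurableSpace (NonemptyCompacts ℂ) := borel _

instance instBorelSpaceNonemptyCompacts : BorelSpace (NonemptyCompacts ℂ) := ⟨rfl⟩

/-! ### 1. Vocabulary: the crux's `let`-bound pieces, named -/

/-- The closed-edge TRACE in `ℂ` of a finite edge set `E` of `ℤ²` at mesh `δ` (the crux's `tr δ E`). -/
def trace (δ : ℝ) (E : Finset (Sym2 (Literature.Probability.LatticeModels.Site 2))) : Set ℂ :=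
  {p : ℂ | ∃ x y : Literature.Probability.LatticeModels.Site 2, s(x, y) ∈ E ∧ p ∈ segment ℝ (Literature.Probability.LatticeModels.meshPoint δ x) (Literature.Probability.LatticeModels.meshPoint δ y)}

/-- The critical POLYGON-GAS MASS of a trace event `P` at mesh `δ`:
`Σ {x_c^{|E|} : E a self-avoiding polygon of ℤ² with P (trace δ E)}` (the crux's `M δ P`). -/
def gasMass (δ : ℝ) (P : Set ℂ → Prop) : ℝ :=
  ∑' E : Finset (Sym2 (Literature.Probability.LatticeModels.Site 2)), (if Literature.Probability.RandomPlanarGeometry.SAW.IsPolygon (Literature.Probability.LatticeModels.zdGraph 2) E ∧ P (trace δ E) then Literature.Probability.RandomPlanarGeometry.SAW.criticalFugacity ^ E.card else (0 : ℝ))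

/-- The CONFORMAL-RADIUS LAW with constant `c` — the hypothesis `C1(c)` of the crux (the body of the route's
`ConformalRadiusLaw` with `c` fixed): the gas mass of polygons drawn in `U`, surrounding `z`, not drawn in `V`
tends to `c · log (|φ_U'(0)| / |φ_V'(0)|)` as `δ → 0⁺`. -/
def CRLaw (c : ℝ) : Prop :=
  ∀ (U V : Literature.Probability.RandomPlanarGeometry.JordanDomain) (z : ℂ) (φ : Literature.Probability.RandomPlanarGeometry.ConformalEquiv (Metric.ball (0 : ℂ) 1) U.carrier) (ψ : Literature.Probability.RandomPlanarGeometry.ConformalEquiv (Metric.ball (0 : ℂ) 1) V.carrier), V.carrier ⊆ U.carrier → z ∈ V.carrier → φ 0 = z → ψ 0 = z → Filter.Tendsto (fun δ : ℝ => gasMass δ (fun T => T ⊆ U.carrier ∧ z ∉ T ∧ Bornology.IsBounded (connectedComponentIn Tᶜ z) ∧ ¬ T ⊆ V.carrier)) (nhdsWithin (0 : ℝ) (Set.Ioi 0)) (nhds (c * Real.log (‖deriv φ 0‖ / ‖deriv ψ 0‖)))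

/-- `ν` is a **Werner window measure** with constant `c` in the window `B(0,R)` — clauses (a), (b), (c) of
the crux's conclusion: `ν`-a.e. point is the trace of a simple loop, `ν`-a.e. point lies in `B(0,R)`, and the
conformal-radius masses hold for all Jordan pairs `V ⊆ U ⊆ B(0,R)`.  (Literally the hypothesis shape of the
route's `WernerDetermination` and `GateFactorisation`; by `WernerDetermination` — proved — two Werner window
measures with the same `(c, R)` are equal.) -/
def IsWernerWindow (ν : MeasureTheory.Measure (NonemptyCompacts ℂ)) (c R : ℝ) : Prop :=
  (∀ᵐ (T : TopologicalSpace.NonemptyCompacts ℂ) ∂ν, ∃ γ : Literature.Probability.RandomPlanarGeometry.CurveClass ℂ, γ ∈ (Literature.Probability.RandomPlanarGeometry.CurveClass.simpleLoop : Set (Literature.Probability.RandomPlanarGeometry.CurveClass ℂ)) ∧ γ.range = (T : Set ℂ)) ∧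
  (∀ᵐ (T : TopologicalSpace.NonemptyCompacts ℂ) ∂ν, (T : Set ℂ) ⊆ Metric.ball (0 : ℂ) R) ∧
  (∀ (U V : Literature.Probability.RandomPlanarGeometry.JordanDomain) (z : ℂ) (φ : Literature.Probability.RandomPlanarGeometry.ConformalEquiv (Metric.ball (0 : ℂ) 1) U.carrier) (ψ : Literature.Probability.RandomPlanarGeometry.ConformalEquiv (Metric.ball (0 : ℂ) 1) V.carrier), U.carrier ⊆ Metric.ball (0 : ℂ) R → V.carrier ⊆ U.carrier → z ∈ V.carrier → φ 0 = z → ψ 0 = z → ν {T : TopologicalSpace.NonemptyCompacts ℂ | (T : Set ℂ) ⊆ U.carrier ∧ z ∉ (T : Set ℂ) ∧ Bornology.IsBounded (connectedComponentIn (T : Set ℂ)ᶜ z) ∧ ¬ (T : Set ℂ) ⊆ V.carrier} = ENNReal.ofReal (c * Real.log (‖deriv φ 0‖ / ‖deriv ψ 0‖)))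

/-- The GATE EVENT `G_ε` of a Dobrushin domain `(Ω; a, b)` in the window `B(0,R)` (the crux's `G ε T`):
`T ⊆ B(0,R)`, `T` avoids `∂Ω` outside the two gate balls `B(a,ε)`, `B(b,ε)`, meets `Ω` away from the closed
gates, meets the outside of `Ω̄ ∪` closed gates, and meets both gate balls. -/
def gate (D : Literature.Probability.RandomPlanarGeometry.DobrushinDomain) (R ε : ℝ) (T : Set ℂ) : Prop :=
  T ⊆ Metric.ball (0 : ℂ) R ∧ T ∩ (frontier D.carrier \ (Metric.ball (D.pt 0) ε ∪ Metric.ball (D.pt 1) ε)) = ∅ ∧ (T ∩ (D.carrier \ closure (Metric.ball (D.pt 0) ε ∪ Metric.ball (D.pt 1) ε))).Nonempty ∧ (T ∩ (closure D.carrier ∪ closure (Metric.ball (D.pt 0) ε ∪ Metric.ball (D.pt 1) ε))ᶜ).Nonempty ∧ (T ∩ Metric.ball (D.pt 0) ε).Nonempty ∧ (T ∩ Metric.ball (D.pt 1) ε).Nonempty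

/-- **Uniform local finiteness of the macroscopic gas** (statement of `stub_localMass`): for every window
`R` and scale `r > 0`, the `x_c`-mass of polygons of `δℤ²` drawn in `B(0,R)` with diameter `≥ r` is bounded
uniformly in `δ ∈ (0, δ₀)`. -/
def LocalMassBound : Prop :=
  ∀ R r : ℝ, 0 < r → ∃ B δ₀ : ℝ, 0 < δ₀ ∧ ∀ δ : ℝ, 0 < δ → δ < δ₀ →
    gasMass δ (fun S => S ⊆ Metric.ball (0 : ℂ) R ∧ r ≤ Metric.diam S) ≤ B

/-- **Thin polygons are asymptotically massless** (statement of `stub_thinDecay`): for every window `R`,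
scale `r > 0` and `θ > 0` there is `ρ > 0` such that, uniformly in `δ ∈ (0, δ₀)`, the `x_c`-mass of polygons
drawn in `B(0,R)` with diameter `≥ r` that surround NO disc of radius `ρ` (no `w` with `B(w,ρ)` off the trace
and `w` in a bounded complementary component) is at most `θ`. -/
def ThinDecay : Prop :=
  ∀ R r θ : ℝ, 0 < r → 0 < θ → ∃ ρ δ₀ : ℝ, 0 < ρ ∧ 0 < δ₀ ∧ ∀ δ : ℝ, 0 < δ → δ < δ₀ →
    gasMass δ (fun S => S ⊆ Metric.ball (0 : ℂ) R ∧ r ≤ Metric.diam S ∧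
      ∀ w : ℂ, Metric.ball w ρ ∩ S = ∅ → ¬ Bornology.IsBounded (connectedComponentIn Sᶜ w)) ≤ θ

/-! ### 2. The registered stubs (the ONLY `sorry`s of this file) -/

/-- **stub 1 — LocalMass (lattice, a-priori).** Uniform local finiteness of the macroscopic critical polygon
gas in windows.  Open on `ℤ²`: it encodes the SAP exponent relation `2 - α = 2ν` (mass of polygons of
diameter `≍ ℓ` near a point is `O(1)` per scale); testable by exact enumeration / transfer matrices. -/
theorem stub_localMass :
    ∀ R r : ℝ, 0 < r → ∃ B δ₀ : ℝ, 0 < δ₀ ∧ ∀ δ : ℝ, 0 < δ → δ < δ₀ →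
      gasMass δ (fun S => S ⊆ Metric.ball (0 : ℂ) R ∧ r ≤ Metric.diam S) ≤ B := by
  sorry

/-- **stub 2 — ThinDecay (lattice, a-priori; trace-level no-pinching).** Macroscopic polygons of the window
that surround no `ρ`-disc carry total `x_c`-mass `≤ θ` for `ρ` small, uniformly in small `δ` (two mutually
avoiding strands at distance `ρ` over length `r` cost a factor exponentially small in `r/ρ` at `x_c`;
equi-regularity of the gas, not implied by `C1`). -/
theorem stub_thinDecay :
    ∀ R r θ : ℝ, 0 < r → 0 < θ → ∃ ρ δ₀ : ℝ, 0 < ρ ∧ 0 < δ₀ ∧ ∀ δ : ℝ, 0 < δ → δ < δ₀ →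
      gasMass δ (fun S => S ⊆ Metric.ball (0 : ℂ) R ∧ r ≤ Metric.diam S ∧
        ∀ w : ℂ, Metric.ball w ρ ∩ S = ∅ → ¬ Bornology.IsBounded (connectedComponentIn Sᶜ w)) ≤ θ := by
  sorry

/-- **stub 3 — existence of the Werner window measure (continuum).** For every `c > 0` and window `R` there
is a measure on `NonemptyCompacts ℂ` carried by simple-loop traces inside `B(0,R)` with the conformal-radius
masses `c · log (|φ_U'(0)| / |φ_V'(0)|)` on all Jordan pairs of the window (Werner 2008, Thm 1 and Prop. 3:
`(c/c₀) ×` the self-avoiding loop measure, restricted to the window; for `R ≤ 0` the zero measure). -/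
theorem stub_wernerWindowExists :
    ∀ c : ℝ, 0 < c → ∀ R : ℝ, ∃ ν : MeasureTheory.Measure (NonemptyCompacts ℂ), IsWernerWindow ν c R := by
  sorry

/-- **stub 4 — gate events have positive finite Werner mass (continuum).** For a Werner window measure and
a Dobrushin domain with closure in the window, `0 < ν(G_ε) < ∞` for all `ε` below a threshold (finite: both
gate balls are met, so `diam T ≥ |a - b| - 2ε`, and Werner's measure is locally finite on macroscopic loops
of a window; positive: Werner's measure charges the loops crossing `∂Ω` exactly inside the two gates). -/
theorem stub_gatePositive :
    ∀ (ν : MeasureTheory.Measure (NonemptyCompacts ℂ)) (c R : ℝ), 0 < c → IsWernerWindow ν c R →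
      ∀ D : Literature.Probability.RandomPlanarGeometry.DobrushinDomain,
        closure D.carrier ⊆ Metric.ball (0 : ℂ) R →
        ∃ ε₁ : ℝ, 0 < ε₁ ∧ ∀ ε : ℝ, 0 < ε → ε < ε₁ →
          0 < ν {T : NonemptyCompacts ℂ | gate D R ε (T : Set ℂ)} ∧
            ν {T : NonemptyCompacts ℂ | gate D R ε (T : Set ℂ)} < ⊤ := by
  sorry

/-- **stub 5 — convergence of the lattice gate masses (lattice → continuum; the hardest stub).** Given
uniform local mass bounds, thin decay, the conformal-radius law with constant `c`, and ANY Werner window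
measure `ν` with constant `c` in the window `R`: for every Dobrushin domain with closure in the window there
is a gate threshold below which `gasMass δ (G_ε) → ν(G_ε)` and `gasMass δ (G_ε ∧ avoid K) → ν(G_ε ∧ avoid K)`
(`K ⊆ Ω` compact regular closed) as `δ → 0⁺`.  By `WernerDetermination` (proved) the target does not depend
on which Werner window measure is supplied. -/
theorem stub_gateConvergence :
    LocalMassBound → ThinDecay → ∀ c : ℝ, 0 < c → CRLaw c →
      ∀ (R : ℝ) (ν : MeasureTheory.Measure (NonemptyCompacts ℂ)), IsWernerWindow ν c R →
        ∀ D : Literature.Probability.RandomPlanarGeometry.DobrushinDomain,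
          closure D.carrier ⊆ Metric.ball (0 : ℂ) R →
          ∃ ε₂ : ℝ, 0 < ε₂ ∧ ∀ ε : ℝ, 0 < ε → ε < ε₂ →
            Filter.Tendsto (fun δ : ℝ => gasMass δ (gate D R ε)) (nhdsWithin (0 : ℝ) (Set.Ioi 0))
                (nhds (ν {T : NonemptyCompacts ℂ | gate D R ε (T : Set ℂ)}).toReal) ∧
              ∀ K : Set ℂ, IsCompact K → K ⊆ D.carrier → closure (interior K) = K →
                Filter.Tendsto (fun δ : ℝ => gasMass δ (fun T => gate D R ε T ∧ T ∩ K = ∅))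
                  (nhdsWithin (0 : ℝ) (Set.Ioi 0))
                  (nhds (ν {T : NonemptyCompacts ℂ | gate D R ε (T : Set ℂ) ∧ (T : Set ℂ) ∩ K = ∅}).toReal) := by
  sorry

/-! ### 3. Name-keyed statements of the stubs — the hypotheses of `GasRegularity_of`

The skeleton audit admits a hypothesis of the skeleton theorem only if its head constant is a registered
obligation or is NAMED like a declared stub; `Sig.stub_X` is the statement of `stub_X` under that name (the
device of the `CoherentMorera` / `AxiomsOfLimit` lines).  Each is `rfl`-equal to its stub's statement, as the
`*_holds` theorems and the wiring `example` at the end certify. -/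
namespace Sig

/-- Statement of `stub_localMass`. -/
abbrev stub_localMass : Prop := LocalMassBound

/-- Statement of `stub_thinDecay`. -/
abbrev stub_thinDecay : Prop := ThinDecay

/-- Statement of `stub_wernerWindowExists`. -/
abbrev stub_wernerWindowExists : Prop :=
  ∀ c : ℝ, 0 < c → ∀ R : ℝ, ∃ ν : MeasureTheory.Measure (NonemptyCompacts ℂ), IsWernerWindow ν c R

/-- Statement of `stub_gatePositive`. -/
abbrev stub_gatePositive : Prop :=
  ∀ (ν : MeasureTheory.Measure (NonemptyCompacts ℂ)) (c R : ℝ), 0 < c → IsWernerWindow ν c R →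
    ∀ D : Literature.Probability.RandomPlanarGeometry.DobrushinDomain,
      closure D.carrier ⊆ Metric.ball (0 : ℂ) R →
      ∃ ε₁ : ℝ, 0 < ε₁ ∧ ∀ ε : ℝ, 0 < ε → ε < ε₁ →
        0 < ν {T : NonemptyCompacts ℂ | gate D R ε (T : Set ℂ)} ∧
          ν {T : NonemptyCompacts ℂ | gate D R ε (T : Set ℂ)} < ⊤

/-- Statement of `stub_gateConvergence`. -/
abbrev stub_gateConvergence : Prop :=
  LocalMassBound → ThinDecay → ∀ c : ℝ, 0 < c → CRLaw c →
    ∀ (R : ℝ) (ν : MeasureTheory.Measure (NonemptyCompacts ℂ)), IsWernerWindow ν c R →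
      ∀ D : Literature.Probability.RandomPlanarGeometry.DobrushinDomain,
        closure D.carrier ⊆ Metric.ball (0 : ℂ) R →
        ∃ ε₂ : ℝ, 0 < ε₂ ∧ ∀ ε : ℝ, 0 < ε → ε < ε₂ →
          Filter.Tendsto (fun δ : ℝ => gasMass δ (gate D R ε)) (nhdsWithin (0 : ℝ) (Set.Ioi 0))
              (nhds (ν {T : NonemptyCompacts ℂ | gate D R ε (T : Set ℂ)}).toReal) ∧
            ∀ K : Set ℂ, IsCompact K → K ⊆ D.carrier → closure (interior K) = K →
              Filter.Tendsto (fun δ : ℝ => gasMass δ (fun T => gate D R ε T ∧ T ∩ K = ∅))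
                (nhdsWithin (0 : ℝ) (Set.Ioi 0))
                (nhds (ν {T : NonemptyCompacts ℂ | gate D R ε (T : Set ℂ) ∧ (T : Set ℂ) ∩ K = ∅}).toReal)

end Sig

/-! Consistency: each named statement IS its registered stub (definitionally). -/

theorem localMass_holds : Sig.stub_localMass := stub_localMass
theorem thinDecay_holds : Sig.stub_thinDecay := stub_thinDecay
theorem wernerWindowExists_holds : Sig.stub_wernerWindowExists := stub_wernerWindowExists
theorem gatePositive_holds : Sig.stub_gatePositive := stub_gatePositive
theorem gateConvergence_holds : Sig.stub_gateConvergence := stub_gateConvergence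

/-! ### 4. The skeleton theorem: the five stubs imply the crux, BY NAME -/

/-- **`GasRegularity` from the line `birth`** (kernel-checked, no `sorry` of its own).  Given `c > 0`, the
conformal-radius law `C1(c)` and a window `R`: take the Werner window measure `ν` of `stub_wernerWindowExists`
(clauses (a)–(c) of the crux are its defining properties); for a Dobrushin domain with closure in the window,
`stub_gatePositive` gives a threshold `ε₁` with `0 < ν(G_ε) < ∞` and `stub_gateConvergence` — fed with
`stub_localMass`, `stub_thinDecay`, `C1(c)` and `ν` — a threshold `ε₂` with the two `δ → 0⁺` limits; the crux's
`ε₀` is `min ε₁ ε₂`.  All identifications with the crux's `let`-bound `tr`, `M`, `G` and its in-statement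
`borel` structure are definitional. -/
theorem GasRegularity_of (hLM : Sig.stub_localMass) (hTD : Sig.stub_thinDecay)
    (hEx : Sig.stub_wernerWindowExists) (hPos : Sig.stub_gatePositive)
    (hConv : Sig.stub_gateConvergence) :
    Summit.CriticalPhenomena.SAWScalingLimit.Theses.SAWLoopLift.GasRegularity := by
  intro c hc hCR R
  obtain ⟨ν, hν⟩ := hEx c hc R
  refine ⟨ν, hν.1, hν.2.1, hν.2.2, ?_⟩
  intro D hD
  obtain ⟨ε₁, hε₁, h₁⟩ := hPos ν c R hc hν D hD
  obtain ⟨ε₂, hε₂, h₂⟩ := hConv hLM hTD c hc hCR R ν hν D hD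
  refine ⟨min ε₁ ε₂, lt_min hε₁ hε₂, fun ε hε hεlt => ?_⟩
  obtain ⟨hpos, hfin⟩ := h₁ ε hε (lt_of_lt_of_le hεlt (min_le_left _ _))
  obtain ⟨hlim, hlimK⟩ := h₂ ε hε (lt_of_lt_of_le hεlt (min_le_right _ _))
  exact ⟨hpos, hfin, hlim, hlimK⟩

/-- Wiring check (an `example`, so that `GasRegularity_of` stays the only theorem concluding the crux): the
registered stubs, with their displayed types, feed the skeleton theorem as stated — this term becomes the crux
proof when the five `sorry`s above are discharged. -/
example : Summit.CriticalPhenomena.SAWScalingLimit.Theses.SAWLoopLift.GasRegularity :=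
  GasRegularity_of stub_localMass stub_thinDecay stub_wernerWindowExists stub_gatePositive
    stub_gateConvergence

end Summit.CriticalPhenomena.SAWScalingLimit.Cruxes.GasRegularity.Birth

end
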